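import Mathlib.Algebra.Module.SnakeLemma
import Mathlib.LinearAlgebra.Dimension.Finrank
import Mathlib.LinearAlgebra.FiniteDimensional.Lemmas
import Mathlib.RingTheory.Finiteness.Basic
import HarnessLib

/-!
# A rank count for compatible endomorphisms of a short exact sequence of vector spaces
# (helper file 3 of the Λ₂ → Λ descent lemma for crux 2 `GoodLatticeBDPValue`, stmt-BirchSwinnertonDyer-19032, cell `bsd-eis` seat `bsd-eis-k5-c2`)

Pure linear algebra (snake lemma + rank–nullity), the counting step of the descent from the
two-variable Iwasawa algebra `Λ₂ = ℤ_p⟦S⟧⟦T⟧` to `Λ = ℤ_p⟦T⟧` (ky MEMO-1 R2 (v); k5-ty SPEC §1 row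
«descent (v)»): after the flat base change `ℚ_p ⊗_{ℤ_p} (·)`, the embedding of the two-variable
Selmer dual `Y` into its elementary module `E` with `ℤ_p⟦S⟧`-torsion cokernel `C` becomes a short
exact sequence of `ℚ_p`-vector spaces `0 → U → W → V → 0` carrying the compatible endomorphisms
"multiplication by `S`" `a, b, c`, with `b` injective (`E` is `ℤ_p⟦S⟧`-free), `V` finite-dimensional
(`C` is `ℤ_p⟦S⟧`-torsion) and `coker b` finite-dimensional of dimension `n = rank_{ℤ_p⟦S⟧} E`
(Weierstrass).

MAIN RESULT (`finiteDimensional_and_finrank_coker_eq_of_exact`): then `coker a` is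
finite-dimensional and `dim coker a = dim coker b`.  Proof: the snake lemma
`0 = ker b → ker c → coker a → coker b → coker c → 0` (Mathlib `SnakeLemma.δ'`,
`exact_δ'_right/left`, plus exactness at `coker b` proved here) and rank–nullity for `c` on the
finite-dimensional `V` (`dim ker c = dim coker c`).

HONEST FRAMING: generic linear algebra; closes nothing by itself.
References: Bourbaki, *Algèbre* II §1 (snake lemma); any linear algebra text (rank–nullity).
-/

-- the summit namespace `Summit.BirchSwinnertonDyer.BirchSwinnertonDyer` repeats the problem name by design (D-0017)
set_option linter.dupNamespace false
set_option autoImplicit false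

noncomputable section

open Function LinearMap Module

namespace Summit.BirchSwinnertonDyer.BirchSwinnertonDyer.Theorems.IwasawaTwoVariable

section Snake

variable {K : Type*} [Field K] {U W V : Type*} [AddCommGroup U] [Module K U]
  [AddCommGroup W] [Module K W] [AddCommGroup V] [Module K V]
  (f : U →ₗ[K] W) (g : W →ₗ[K] V) (a : U →ₗ[K] U) (b : W →ₗ[K] W) (c : V →ₗ[K] V)

/-- The map induced by `f` on cokernels `coker a → coker b` when `f ∘ a = b ∘ f`. [folklore] -/
theorem range_le_comap_range (hab : f.comp a = b.comp f) :
    LinearMap.range a ≤ (LinearMap.range b).comap f := by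
  rintro _ ⟨u, rfl⟩
  exact ⟨f u, (LinearMap.congr_fun hab u).symm⟩

/-- Exactness of the cokernel row `coker a → coker b → coker c` at `coker b`, for a short exact
sequence `U → W → V → 0` (exact at `W`, `g` surjective) with compatible endomorphisms. [folklore] -/
theorem exact_mapQ_mapQ (hfg : Exact f g) (hg : Surjective g)
    (hab : f.comp a = b.comp f) (hbc : g.comp b = c.comp g) :
    Exact ((LinearMap.range a).mapQ (LinearMap.range b) f (range_le_comap_range f a b hab))
      ((LinearMap.range b).mapQ (LinearMap.range c) g (range_le_comap_range g b c hbc)) := by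
  intro x
  induction x using Submodule.Quotient.induction_on with
  | H w =>
    constructor
    · intro hw
      rw [Submodule.mapQ_apply, Submodule.Quotient.mk_eq_zero, LinearMap.mem_range] at hw
      obtain ⟨v, hv⟩ := hw
      obtain ⟨w', rfl⟩ := hg v
      have h0 : g (w - b w') = 0 := by
        rw [map_sub, sub_eq_zero, ← hv]
        exact (LinearMap.congr_fun hbc w').symm
      obtain ⟨u, hu⟩ := (hfg (w - b w')).1 h0
      refine ⟨Submodule.Quotient.mk u, ?_⟩
      rw [Submodule.mapQ_apply, hu, Submodule.Quotient.eq]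
      exact ⟨-w', by rw [map_neg]; abel⟩
    · rintro ⟨x, hx⟩
      induction x using Submodule.Quotient.induction_on with
      | H u =>
        rw [Submodule.mapQ_apply, Submodule.Quotient.eq] at hx
        obtain ⟨w'', hw''⟩ := hx
        have hw : w = f u - b w'' := by rw [hw'']; exact (sub_sub_cancel _ _).symm
        rw [Submodule.mapQ_apply, Submodule.Quotient.mk_eq_zero]
        refine ⟨-g w'', ?_⟩
        rw [hw, map_sub, hfg.apply_apply_eq_zero, zero_sub, map_neg, neg_inj]
        exact (LinearMap.congr_fun hbc w'').symm

variable {f g a b c}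

/-- **Rank count.**  For an exact sequence `0 → U → W → V → 0` of `K`-vector spaces with compatible
endomorphisms `a, b, c`, `b` injective, `V` and `coker b` finite-dimensional: `coker a` is
finite-dimensional and `dim coker a = dim coker b` (snake lemma: `0 → ker c → coker a → coker b →
coker c → 0`, and `dim ker c = dim coker c` by rank–nullity on `V`). [folklore] -/
theorem finiteDimensional_and_finrank_coker_eq_of_exact (hf : Injective f) (hg : Surjective g)
    (hfg : Exact f g) (hab : f.comp a = b.comp f) (hbc : g.comp b = c.comp g) (hb : Injective b)
    [FiniteDimensional K V] [FiniteDimensional K (W ⧸ LinearMap.range b)] :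
    FiniteDimensional K (U ⧸ LinearMap.range a) ∧
      finrank K (U ⧸ LinearMap.range a) = finrank K (W ⧸ LinearMap.range b) := by
  -- the snake: `δ : ker c → coker a`, injective since `ker b = 0`, exact at `coker a`
  set G := (LinearMap.range a).mapQ (LinearMap.range b) f (range_le_comap_range f a b hab) with hG
  set G' := (LinearMap.range b).mapQ (LinearMap.range c) g (range_le_comap_range g b c hbc)
    with hG'
  have hι₃ : Exact (LinearMap.ker c).subtype c := LinearMap.exact_subtype_ker_map c
  have hπ₁ : Exact a (LinearMap.range a).mkQ := LinearMap.exact_map_mkQ_range a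
  have hπ₂ : Exact b (LinearMap.range b).mkQ := LinearMap.exact_map_mkQ_range b
  let δ : LinearMap.ker c →ₗ[K] U ⧸ LinearMap.range a :=
    SnakeLemma.δ' a b c f g hfg f g hfg hab hbc (LinearMap.ker c).subtype hι₃
      (LinearMap.range a).mkQ hπ₁ hg hf
  -- exactness `0 → ker c → coker a` (from `ker b = 0`)
  have hι₂ : Exact (⊥ : Submodule K W).subtype b := by
    intro w
    constructor
    · intro hw
      have hw0 : w = 0 := hb (by rw [hw, map_zero])
      exact ⟨⟨0, (⊥ : Submodule K W).zero_mem⟩, by rw [hw0]; rfl⟩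
    · rintro ⟨⟨x, hx⟩, rfl⟩
      have hx0 : x = 0 := (Submodule.mem_bot K).1 hx
      subst hx0
      simp
  have hF : g.comp (⊥ : Submodule K W).subtype =
      (LinearMap.ker c).subtype.comp (0 : (⊥ : Submodule K W) →ₗ[K] LinearMap.ker c) := by
    refine LinearMap.ext fun x => ?_
    obtain ⟨x, hx⟩ := x
    have hx0 : x = 0 := (Submodule.mem_bot K).1 hx
    subst hx0
    simp
  have hδinj : Injective δ := by
    have hex := SnakeLemma.exact_δ'_right a b c f g hfg f g hfg hab hbc
      (⊥ : Submodule K W).subtype hι₂ (LinearMap.ker c).subtype hι₃ (LinearMap.range a).mkQ hπ₁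
      hg hf (0 : (⊥ : Submodule K W) →ₗ[K] LinearMap.ker c) hF (Submodule.injective_subtype _)
    rw [← LinearMap.ker_eq_bot, LinearMap.exact_iff.1 hex, LinearMap.range_zero]
  -- exactness `ker c → coker a → coker b`
  have hexδG : Exact δ G :=
    SnakeLemma.exact_δ'_left a b c f g hfg f g hfg hab hbc (LinearMap.ker c).subtype hι₃
      (LinearMap.range a).mkQ hπ₁ (LinearMap.range b).mkQ hπ₂ hg hf G
      (Submodule.mapQ_mkQ _ _ _) (Submodule.mkQ_surjective _)
  -- exactness `coker a → coker b → coker c → 0`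
  have hexGG' : Exact G G' := exact_mapQ_mapQ f g a b c hfg hg hab hbc
  have hG'surj : Surjective G' := by
    rintro x
    induction x using Submodule.Quotient.induction_on with
    | H v =>
      obtain ⟨w, rfl⟩ := hg v
      exact ⟨Submodule.Quotient.mk w, rfl⟩
  -- finite-dimensionality of `coker a`
  have hkerG : LinearMap.ker G = LinearMap.range δ := (LinearMap.exact_iff.1 hexδG)
  have hfin : FiniteDimensional K (U ⧸ LinearMap.range a) := by
    refine Module.finite_def.2 (Submodule.fg_of_fg_map_of_fg_inf_ker G ?_ ?_)
    · exact IsNoetherian.noetherian _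
    · rw [top_inf_eq, hkerG]
      exact Module.Finite.iff_fg.1 inferInstance
  refine ⟨hfin, ?_⟩
  -- the count
  have h1 := LinearMap.finrank_range_add_finrank_ker c
  have h2 := (LinearMap.range c).finrank_quotient_add_finrank
  have h3 : finrank K (LinearMap.range δ) = finrank K (LinearMap.ker c) :=
    LinearMap.finrank_range_of_inj hδinj
  have h4 := LinearMap.finrank_range_add_finrank_ker G
  have h5 := LinearMap.finrank_range_add_finrank_ker G'
  have h6 : finrank K (LinearMap.range G') = finrank K (V ⧸ LinearMap.range c) := by
    rw [LinearMap.range_eq_top.2 hG'surj, finrank_top]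
  rw [hkerG, h3] at h4
  rw [LinearMap.exact_iff.1 hexGG', h6] at h5
  omega

end Snake

end Summit.BirchSwinnertonDyer.BirchSwinnertonDyer.Theorems.IwasawaTwoVariable

end
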